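import Literature.NumberTheory.Automorphic.FreitasLeHungSiksekLifting
import Literature.NumberTheory.Automorphic.TotallyRealModularityBoxImages
import HarnessLib

/-!
# Residual images of a non-modular elliptic curve over a totally real field — bookkeeping
# for the trace-only rendering of "modular" (Box 2022, Thm. 1.3; FLS 2015, Thms. 3–4)

Topic `Literature/NumberTheory/Automorphic`; a *proofs* file (theorems only; NO definitions, NO
named facts). History (2026-08-16/17): three parallel grounder seats of route
`Summit.Langlands.Langlands.Theses.SqrtFiveQuarticCovers` vendored the same two printed statements
within minutes of each other and all three files were applied by the gate:

* `FreitasLeHungSiksekLifting.lean` — the named fact `FLS2015_theorems3_4` (N. Freitas,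
  B. V. Le Hung, S. Siksek, Invent. Math. 201 (2015), Thms. 3 and 4: "`ρ̄_{E,p}(G_{K(ζ_p)})`
  absolutely irreducible for some `p ∈ {3, 5, 7}` ⇒ `E` modular", any totally real `K`) and its API;
* `TotallyRealModularityBoxImages.lean` — the named fact `Box2022_theorem1_3` (J. Box, Trans. AMS
  375 (2022), Thm. 1.3: a non-modular `E` over a totally real `K` has (i) mod-`3` image in `B(3)` or
  `C_s⁺(3)`, (ii) mod-`5` image in `B(5)` if `√5 ∉ K`, (iii) mod-`7` image in `B(7)` or `G(e7)` if
  `K ∩ ℚ(ζ₇) = ℚ`, rendered with framings `WeierstrassCurve.IsTorsionGaloisRep`) and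
  `Box2022_theorem1_3.quartic`;
* the first version of THIS file, which carried its own copies of both facts under the SAME
  fully-qualified names (identical body for the FLS fact; Box's (iii) hypothesis phrased as
  "`ζ₇ + ζ₇⁻¹ ∉ K`" instead of "the cubic `X³ + X² - 2X - 1` has no root in `K`" — equivalent for
  number fields).

One fully-qualified name, one module: this revision DELETES both copies, imports the two canonical
files, and keeps only what they do not contain — the passage to the WEAK trace-only rendering
`IsModularEllipticCurve K E` of Caraiani–Newton, which is the notion the `Langlands` route files
write out by its definition (cone repair of 2026-08-16):

* `not_isAutomorphicOfWeightZero_of_not_isModularEllipticCurve` — `¬ IsModularEllipticCurve K E →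
  ¬ IsAutomorphicOfWeightZero E` for `Δ(E) ≠ 0` (contrapositive of the proved bridges
  `IsHilbertModular.of_isAutomorphicOfWeightZero`, `IsHilbertModular.isModularEllipticCurve` of
  `TotallyRealModularity`);
* `Box2022_theorem1_3.quartic_of_not_isModularEllipticCurve` — Thm. 1.3 (i), (iii) over a quartic
  field from `¬ IsModularEllipticCurve` with `IsTotallyReal K` as an explicit hypothesis: LITERALLY
  the `3`- and `7`-clauses of `SqrtFiveQuarticCovers.ReductionToRefinedLocus` (ledger
  stmt-Langlands-17834; definitionally equal to its unfolded rev-5 text);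
* `Box2022_theorem1_3.borel_five` — Thm. 1.3 (ii) in the same weak form (`¬ IsSquare (5 : K)`), the
  reduction at `5` behind `Box2022_theorem1_1` / `SqrtFiveQuarticCovers.BoxQuartic`.

## References

* [Box2022] J. Box, Trans. AMS 375 (2022), doi:10.1090/tran/8557 = arXiv:2103.13975, Thm. 1.3
  (p. 4 of the held text `paper:arxiv-2103.13975`).
* [FreitasLeHungSiksek2015] Invent. Math. 201 (2015) 159–206, Thms. 3–4 (pp. 4–5 of the held text
  `paper:arxiv-1310.7088`).
-/

open scoped NumberField MatrixGroups
open NumberField Field Literature.NumberTheory.GaloisRepresentations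

noncomputable section

namespace Literature.NumberTheory.Automorphic

/-- Non-modularity in the weak trace-only sense of Caraiani–Newton (`IsModularEllipticCurve`,
the rendering used by the `Langlands` routes) implies non-modularity in the strong sense
`IsAutomorphicOfWeightZero` (contrapositive of the two proved bridges
`IsHilbertModular.of_isAutomorphicOfWeightZero`, `IsHilbertModular.isModularEllipticCurve`).
[folklore] -/
theorem not_isAutomorphicOfWeightZero_of_not_isModularEllipticCurve {K : Type} [Field K]
    [NumberField K] {E : WeierstrassCurve (𝓞 K)} (hΔ : E.Δ ≠ 0)
    (h : ¬ IsModularEllipticCurve K E) : ¬ IsAutomorphicOfWeightZero E := fun hA =>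
  h (IsHilbertModular.of_isAutomorphicOfWeightZero hΔ hA).isModularEllipticCurve

/-- **Box 2022, Thm. 1.3 (i) and (iii) over a quartic field, for the weak rendering of
"modular".** For `K` totally real of degree `4` (hypothesis of (iii) automatic:
`Box2022.cubic7_ne_zero`, `3 ∤ 4`), a curve `E / 𝓞 K` (`Δ ≠ 0`) that is not modular even in the
trace-only sense `IsModularEllipticCurve` has `Im ρ̄_{E,3}` inside `B(3)` or `C_s⁺(3)` and
`Im ρ̄_{E,7}` inside `B(7)` or `G(e7)` for suitable framings — the `3`- and `7`-clauses of
`SqrtFiveQuarticCovers.ReductionToRefinedLocus`, verbatim (`IsTotallyReal K` explicit, as there).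
From `Box2022_theorem1_3.quartic` (file `TotallyRealModularityBoxImages`).
[cite: Box2022, Thm. 1.3 (i), (iii)] -/
theorem Box2022_theorem1_3.quartic_of_not_isModularEllipticCurve (h : Box2022_theorem1_3)
    (K : Type) [Field K] [NumberField K] (hK : IsTotallyReal K) (hd : Module.finrank ℚ K = 4)
    (E : WeierstrassCurve (𝓞 K)) (hΔ : E.Δ ≠ 0) (hE : ¬ IsModularEllipticCurve K E) :
    (∃ ρ : FramedGaloisRep K (ZMod 3) 2, (E.baseChange K).IsTorsionGaloisRep 3 ρ ∧
        ((∀ σ : absoluteGaloisGroup K,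
            ((ρ σ : GL (Fin 2) (ZMod 3)) : Matrix (Fin 2) (Fin 2) (ZMod 3)) 1 0 = 0) ∨
         (∀ σ : absoluteGaloisGroup K, (ρ σ : GL (Fin 2) (ZMod 3)) ∈
            Subgroup.closure ({(⟨!![1, 0; 0, 2], !![1, 0; 0, 2], by decide, by decide⟩ :
                GL (Fin 2) (ZMod 3)),
              (⟨!![0, 1; 1, 0], !![0, 1; 1, 0], by decide, by decide⟩ : GL (Fin 2) (ZMod 3))} :
                Set (GL (Fin 2) (ZMod 3)))))) ∧
    (∃ ρ : FramedGaloisRep K (ZMod 7) 2, (E.baseChange K).IsTorsionGaloisRep 7 ρ ∧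
        ((∀ σ : absoluteGaloisGroup K,
            ((ρ σ : GL (Fin 2) (ZMod 7)) : Matrix (Fin 2) (Fin 2) (ZMod 7)) 1 0 = 0) ∨
         (∀ σ : absoluteGaloisGroup K, (ρ σ : GL (Fin 2) (ZMod 7)) ∈
            Subgroup.closure ({(⟨!![0, 5; 3, 0], !![0, 5; 3, 0], by decide, by decide⟩ :
                GL (Fin 2) (ZMod 7)),
              (⟨!![5, 0; 3, 2], !![3, 0; 6, 4], by decide, by decide⟩ : GL (Fin 2) (ZMod 7))} :
                Set (GL (Fin 2) (ZMod 7)))))) := by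
  haveI := hK
  exact h.quartic K hd hΔ (not_isAutomorphicOfWeightZero_of_not_isModularEllipticCurve hΔ hE)

/-- **Box 2022, Thm. 1.3 (ii), weak rendering.** Over a totally real `K` with `√5 ∉ K`
(`¬ IsSquare (5 : K)`), a curve `E / 𝓞 K` (`Δ ≠ 0`) not modular in the trace-only sense has
`Im ρ̄_{E,5}` inside `B(5)` for a suitable framing — the reduction at `5` behind Box's Thm. 1.1
(`Box2022_theorem1_1`). [cite: Box2022, Thm. 1.3 (ii)] -/
theorem Box2022_theorem1_3.borel_five (h : Box2022_theorem1_3) (K : Type) [Field K] [NumberField K]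
    (hK : IsTotallyReal K) (h5 : ¬ IsSquare (5 : K)) (E : WeierstrassCurve (𝓞 K))
    (hΔ : E.Δ ≠ 0) (hE : ¬ IsModularEllipticCurve K E) :
    ∃ ρ : FramedGaloisRep K (ZMod 5) 2, (E.baseChange K).IsTorsionGaloisRep 5 ρ ∧
      ∀ σ : absoluteGaloisGroup K,
        ((ρ σ : GL (Fin 2) (ZMod 5)) : Matrix (Fin 2) (Fin 2) (ZMod 5)) 1 0 = 0 := by
  haveI := hK
  exact (h K E hΔ (not_isAutomorphicOfWeightZero_of_not_isModularEllipticCurve hΔ hE)).2.1 h5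

end Literature.NumberTheory.Automorphic

end
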